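import Literature.NumberTheory.GelbartRogawski1991.LocalScaleModelTransport
import Literature.RepresentationTheory.HeisenbergGroup.SchrodingerConjugateGram
import Literature.RepresentationTheory.HeisenbergGroup.MetaplecticBoxHom
import HarnessLib

/-!
# The CONJUGATE SECTION: `conj ∘ ω_s ∘ conj` is the Weil representation of `U(J)(F_v)` along a section over `ι^T_{−δ}` — on the SAME
# model `𝒮(F_vᴺ)` of `β_T`

Topic `NumberTheory/GelbartRogawski1991`; namespace `Literature.NumberTheory.GelbartRogawski1991.UnitaryDualPair.LocalSplitting` (that of ★
`LocalUnitarySplittingDatum`, ★ `LocalScaleModelTransport`).  KERNEL mathematics only: theorems (an `∃`-statement for the new section — no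
definition, no named fact, no `sorry`, no instance, no notation).  Cell hodgecm-mathlib, fan B rung B-IV; `--supports stmt-HodgeConjecture-24832`.

SETTING: `E/F` quadratic (`c`, `δ` with `c δ = −δ`, `δ² = d`), a symmetric `T ∈ GL_N(F)` with `J = T ⊗ 1`, a finite place `v`; the local
Schrödinger model `ρ_T = localSchrodinger F N T v` of `𝒮(F_vᴺ)`, MVW's group of pairs `S̃p_ψ(𝕎_v, β_T) = LocalMp F N T v`, and the
embeddings `ι^T_δ, ι^T_{−δ} : U(J)(F_v) → Sp(𝕎_v, β_T)` (restriction of scalars in the coordinates `x + δ y`, resp. `x + (−δ) y`; in the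
tree `−δ` is the «line element» `lineDelta (−1) = (−1)⁻¹ δ` of ★ `LocalLineModelTransport`).

* §1 `localPairing_neg` — `β_{−T} = −β_T`; `coe_iota_neg_scaleInl` — the embedding of `U(−J)(F_v) = U(J)(F_v)` into `Sp(β_{−T})` has the
  SAME underlying linear map as `ι^T_δ` (both are `u ↦ k u` in the coordinates of `δ`).
* §2 **`exists_conjSection`** — for every section `s` over `ι^T_δ` there is a section `s̄ : U(J)(F_v) →* S̃p_ψ(𝕎_v, β_T)` over `ι^T_{−δ}` whose
  operators are the CONJUGATES `toOp (s̄ g) = conj ∘ toOp (s g) ∘ conj` (★ `conjOp`): the pair `(ι^T_δ g, M)` of `β_T` gives the pair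
  `(ι^T_δ g, conjOp M)` of `β_{−T} = −β_T` (★ `implements_conjOp_ofSymplectic_of_eq_neg`), which the same-space scale transport `a = −1`
  (★ `implements_iff_implements_symplecticConj_lineScale_of_eq_smul`, ★ `symplecticConj_lineScale_iota_scaleInl`) reads as the pair
  `(ι^T_{−δ} g, conjOp M)` of `β_T`.  With `toRep_conjSection`-shaped corollaries: `ω_{s̄}(g) f = conj (ω_s(g) (conj f))`, and `ω_{s̄}` is smooth when
  `ω_s` is (`isSmooth_of_conj`).

So «the complex conjugate of the oscillator representation of the line `δ` is the oscillator representation of the line `−δ`»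
([MoeglinVignerasWaldspurger1987, Chap. 2 II.1 Remarque: `ω̄_ψ = ω_{ψ̄}`; Chap. 4 II.1]; [HarrisKudlaSweet1996, §1 (1.4)] `W⁻`), in the section currency of ★
`rankOne_theta_dichotomy` ∕ ★ `nonPeriodic₁₁_holds` (sections into ONE `LocalMp F N T v` over `ι_{δ₁}`, `ι_{δ₂}`).  Consumer: the see-saw on the
anisotropic plane ([Liu2021, Lem. D.1 (1)], n = 2) through ★ `TwistedCoinv.nontrivial_coinv_iff_inv_of_conj`.  HC_CM is proved only modulo the printed
citations — the 2 remaining named inputs (hLiu418 = stmt-HodgeConjecture-24832, h413 = 24833) — until rung 0 closes; count-neutral.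

## References
* [MoeglinVignerasWaldspurger1987] C. Mœglin, M.-F. Vignéras, J.-L. Waldspurger, LNM 1291 (1987), Chap. 2 II.1 (A)–(B) and Remarque; Chap. 4 II.1.
* [HarrisKudlaSweet1996] M. Harris, S. Kudla, W. J. Sweet, J. AMS 9 (1996), §1 (1.4), (1.9).
* [Weil1964] A. Weil, Acta Math. 111 (1964), n° 5, n° 34.
-/

set_option autoImplicit false

noncomputable section

open scoped Matrix
open NumberField IsDedekindDomain
open Literature.RepresentationTheory.HeisenbergGroup
open Literature.NumberTheory.Automorphic Literature.NumberTheory.Automorphic.UnitaryGroup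

namespace Literature.NumberTheory.GelbartRogawski1991.UnitaryDualPair.LocalSplitting

variable (F E : Type) [Field F] [NumberField F] [Field E] [NumberField E] [Algebra F E]
  [Algebra.IsQuadraticExtension F E] (c : E ≃ₐ[F] E) (N : ℕ)
  {δ : E} (hcδ : c δ = -δ) (hδ : δ ≠ 0) {d : F} (hd : δ * δ = algebraMap F E d)
  (T : Matrix (Fin N) (Fin N) F) (hT : T.IsSymm)
  {J : Matrix (Fin N) (Fin N) E} (hJ : J = T.map (algebraMap F E))
  (v : HeightOneSpectrum (𝓞 F))

/-! ## §1 `β_{−T} = −β_T`; the embedding into `Sp(β_{−T})` has the linear map of `ι^T_δ` -/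

omit [NumberField F] in
/-- `−T = (−1) • T` with `−1 ∈ Fˣ` (the scale-transport hypothesis `hTT'` of ★ `LocalScaleModelTransport` at `a = −1`).
[cite: GelbartRogawski1991, §3.1 p. 454] -/
theorem neg_eq_units_neg_one_smul : -T = ((-1 : Fˣ) : F) • T := by
  rw [Units.val_neg, Units.val_one, neg_one_smul]

omit [NumberField F] in
include hT in
/-- `−T` is symmetric (the Gram matrix of the opposite space `𝕎⁻`). [cite: HarrisKudlaSweet1996, §1 (1.4)] -/
theorem isSymm_neg_of_isSymm : (-T).IsSymm := by
  unfold Matrix.IsSymm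
  rw [Matrix.transpose_neg, hT.eq]

omit [NumberField F] [NumberField E] [Algebra.IsQuadraticExtension F E] in
include hJ in
/-- `−J = (−T) ⊗ 1` (the hermitian form of the opposite space). [cite: HarrisKudlaSweet1996, §1 (1.4)] [cite: GelbartRogawski1991, §3.1 p. 454] -/
theorem neg_herm_eq_map : -J = (-T).map (algebraMap F E) := by
  rw [hJ, Matrix.map_neg _ (map_neg (algebraMap F E))]

/-- **`β_{−T} = −β_T`** (the local pairings of `−T` and `T`). [cite: Weil1964, n° 34, p. 182] -/
theorem localPairing_neg : localPairing F N (-T) v = -localPairing F N T v := by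
  refine LinearMap.ext fun x => LinearMap.ext fun y => ?_
  rw [localPairing_of_eq_smul F N T (-T) (-1) (neg_eq_units_neg_one_smul F N T) v, LinearMap.neg_apply, LinearMap.neg_apply,
    Units.val_neg, Units.val_one, map_neg, map_one, neg_smul, one_smul, map_neg]

/-- **The embedding `ι^{−T}_δ ∘ scaleInl : U(J)(F_v) → Sp(β_{−T})` has the underlying linear map of `ι^T_δ`** (both are `u ↦ k u` on
`E_vᴺ` in the coordinates `u = x + δ y`; only the ambient symplectic group differs). [cite: MoeglinVignerasWaldspurger1987, Chap. 1 I.17] -/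
theorem coe_iota_neg_scaleInl (k : localPi E c N J v) :
    ((iota F E c N hcδ hδ hd (-T) (isSymm_neg_of_isSymm F N T hT) (neg_herm_eq_map F E N T hJ) v
        (scaleInl F E c N T (-T) (-1) (neg_eq_units_neg_one_smul F N T) hJ (neg_herm_eq_map F E N T hJ) v k)).1 :
        ((Fin N → v.adicCompletion F) × (Fin N → v.adicCompletion F)) ≃ₗ[v.adicCompletion F]
          ((Fin N → v.adicCompletion F) × (Fin N → v.adicCompletion F))) =
      (iota F E c N hcδ hδ hd T hT hJ v k).1 := by
  refine LinearEquiv.ext fun w => ?_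
  rw [iota_def, iota_def]
  change (localToSymplectic E c N v hcδ hδ hd (isSymm_neg_of_isSymm F N T hT) (neg_herm_eq_map F E N T hJ)
      (localPiEquiv E c N _ v (scaleInl F E c N T (-T) (-1) (neg_eq_units_neg_one_smul F N T) hJ (neg_herm_eq_map F E N T hJ) v k))).1 w =
    (localToSymplectic E c N v hcδ hδ hd hT hJ (localPiEquiv E c N J v k)).1 w
  set x := (QuadraticCoordinates.reIm (quadraticLocalEquiv E v c hcδ hδ).toLinearEquiv.toAddEquiv (Fin N)).symm w with hx
  have hw : w = QuadraticCoordinates.reIm (quadraticLocalEquiv E v c hcδ hδ).toLinearEquiv.toAddEquiv (Fin N) x := by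
    rw [hx, AddEquiv.apply_symm_apply]
  rw [hw, localToSymplectic_reIm, localToSymplectic_reIm, coe_localPiEquiv_scaleInl]


/-! ## §2 The conjugate section over `ι^T_{−δ}` with operators `conj ∘ toOp (s g) ∘ conj` -/

/-- `u ↦ β_{𝕋_v}(u, y)` is continuous (a linear form in finitely many coordinates). [folklore] -/
private theorem continuous_localPairing_left₀ (T₀ : Matrix (Fin N) (Fin N) F) (y : Fin N → v.adicCompletion F) :
    Continuous fun u : Fin N → v.adicCompletion F => localPairing F N T₀ v u y := by
  change Continuous fun u : Fin N → v.adicCompletion F => Matrix.toLinearMap₂' (v.adicCompletion F) (localGram F N T₀ v) u y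
  simp only [Matrix.toLinearMap₂'_apply', dotProduct]
  exact continuous_finsetSum _ fun i _ => (continuous_apply i).mul continuous_const

section ConjSection

variable (s : localPi E c N J v →* LocalMp F N T v) (hs : ∀ g, MpPsi.proj _ (s g) = iota F E c N hcδ hδ hd T hT hJ v g)

include hs in
/-- **The conjugate pair lies in `S̃p_ψ(𝕎_v, β_T)` over `ι^T_{−δ}`**: for `g ∈ U(J)(F_v)` with `s g = (ι^T_δ g, M)`, the pair
`(ι^T_{−δ} g, conj ∘ M ∘ conj)` satisfies MVW's condition (A) for `ρ_T` — `Literature.RepresentationTheory.HeisenbergGroup.conjOp M` implements `ι^T_δ g` for `ρ_{−T}` (`β_{−T} = −β_T`,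
★ `implements_conjOp_ofSymplectic_of_eq_neg`), i.e. `e′ (ι^T_δ g) e′⁻¹ = ι^T_{−δ} g` for `ρ_T` under the same-space transport `e′ : (x, y) ↦ (x, −y)`
(★ `implements_iff_implements_symplecticConj_lineScale_of_eq_smul`, ★ `symplecticConj_lineScale_iota_scaleInl`, `coe_iota_neg_scaleInl`).
[cite: MoeglinVignerasWaldspurger1987, Chap. 2 II.1 (A)–(B) and Remarque] [cite: HarrisKudlaSweet1996, §1 (1.4)] -/
theorem conjOp_iota_mem_localMp (g : localPi E c N J v) :
    ((iota F E c N (conj_lineDelta hcδ (-1)) (lineDelta_ne_zero hδ (-1)) (lineDelta_mul_self hd (-1)) T hT hJ v g,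
        Literature.RepresentationTheory.HeisenbergGroup.conjOp (MpPsi.toOp _ (s g))) :
      LocalSp F N T v × (SchwartzBruhat (Fin N → v.adicCompletion F) ≃ₗ[ℂ] SchwartzBruhat (Fin N → v.adicCompletion F))) ∈
      MpPsi (localSchrodinger F N T v) := by
  -- (1) `M` implements `ι^T_δ g` on `ρ_T`
  have h1 : Implements (localSchrodinger F N T v) (ofSymplectic _ (s g).1.1) (s g).1.2 := (mem_MpPsi _ _).1 (s g).2
  -- the symplectic element read in `Sp(β_{−T})`
  have hg' : ((s g).1.1).1 ∈ symplecticGroup (polar (localPairing F N (-T) v)) :=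
    (mem_symplecticGroup_iff_of_eq_neg (localPairing_neg F N T v) _).2 (s g).1.1.2
  -- (2) `Literature.RepresentationTheory.HeisenbergGroup.conjOp M` implements it on `ρ_{−T}`
  have h2 : Implements (localSchrodinger F N (-T) v) (ofSymplectic _ ⟨((s g).1.1).1, hg'⟩) (Literature.RepresentationTheory.HeisenbergGroup.conjOp (s g).1.2) :=
    implements_conjOp_ofSymplectic_of_eq_neg
      (isLocallyConstant_of_isContinuousNontrivial (isContinuousNontrivial_adeleAddCharAt F v))
      (continuous_localPairing_left₀ F N v T) (continuous_localPairing_left₀ F N v (-T))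
      (localPairing_neg F N T v) hg' h1
  -- (3) same-space transport `a = −1`: `Literature.RepresentationTheory.HeisenbergGroup.conjOp M` implements `e′ (ι^T_δ g) e′⁻¹` on `ρ_T`
  have h3 := (implements_iff_implements_symplecticConj_lineScale_of_eq_smul F N T (-T) (-1) (neg_eq_units_neg_one_smul F N T) v
    ⟨((s g).1.1).1, hg'⟩ (Literature.RepresentationTheory.HeisenbergGroup.conjOp (s g).1.2)).2 h2
  -- (4) `⟨ι^T_δ g⟩ = ι^{−T}_δ (scaleInl g)` in `Sp(β_{−T})`, and `e′ ι^{−T}_δ(scaleInl g) e′⁻¹ = ι^T_{−δ} g`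
  have h4 : (⟨((s g).1.1).1, hg'⟩ : LocalSp F N (-T) v) =
      iota F E c N hcδ hδ hd (-T) (isSymm_neg_of_isSymm F N T hT) (neg_herm_eq_map F E N T hJ) v
        (scaleInl F E c N T (-T) (-1) (neg_eq_units_neg_one_smul F N T) hJ (neg_herm_eq_map F E N T hJ) v g) := by
    apply Subtype.ext
    rw [coe_iota_neg_scaleInl F E c N hcδ hδ hd T hT hJ v g, ← hs g, MpPsi.proj_apply]
  rw [h4, symplecticConj_lineScale_iota_scaleInl F E c N hcδ hδ hd T (-T) hT (isSymm_neg_of_isSymm F N T hT) (-1)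
    (neg_eq_units_neg_one_smul F N T) hJ (neg_herm_eq_map F E N T hJ) v g] at h3
  rw [mem_MpPsi]
  exact h3

include hs in
/-- **THE CONJUGATE SECTION.**  For every section `s : U(J)(F_v) →* S̃p_ψ(𝕎_v, β_T)` over `ι^T_δ` there is a section
`s̄ : U(J)(F_v) →* S̃p_ψ(𝕎_v, β_T)` over `ι^T_{−δ}` (`−δ = lineDelta (−1)`) whose operators are the conjugates: `toOp (s̄ g) = conj ∘ toOp (s g) ∘ conj`.
So `ω_{s̄} = conj ∘ ω_s ∘ conj` is the oscillator representation of the line `−δ` on the same model — «`ω̄_ψ = ω_{ψ̄}` is the Weil representation of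
`𝕎⁻`». [cite: MoeglinVignerasWaldspurger1987, Chap. 2 II.1 Remarque; Chap. 4 II.1] [cite: HarrisKudlaSweet1996, §1 (1.4)] -/
theorem exists_conjSection :
    ∃ s' : localPi E c N J v →* LocalMp F N T v,
      (∀ g, MpPsi.proj _ (s' g) =
          iota F E c N (conj_lineDelta hcδ (-1)) (lineDelta_ne_zero hδ (-1)) (lineDelta_mul_self hd (-1)) T hT hJ v g) ∧
      (∀ g, MpPsi.toOp _ (s' g) = Literature.RepresentationTheory.HeisenbergGroup.conjOp (MpPsi.toOp _ (s g))) := by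
  -- `Literature.RepresentationTheory.HeisenbergGroup.conjOp` as a homomorphism of the automorphism group of `𝒮(F_vᴺ)`
  let C : (SchwartzBruhat (Fin N → v.adicCompletion F) ≃ₗ[ℂ] SchwartzBruhat (Fin N → v.adicCompletion F)) →*
      (SchwartzBruhat (Fin N → v.adicCompletion F) ≃ₗ[ℂ] SchwartzBruhat (Fin N → v.adicCompletion F)) :=
    { toFun := Literature.RepresentationTheory.HeisenbergGroup.conjOp, map_one' := conjOp_one, map_mul' := fun M M' => conjOp_mul M M' }
  -- the pair homomorphism `g ↦ (ι^T_{−δ} g, Literature.RepresentationTheory.HeisenbergGroup.conjOp (toOp (s g)))`, co-restricted to `S̃p_ψ(𝕎_v, β_T)`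
  refine ⟨((iota F E c N (conj_lineDelta hcδ (-1)) (lineDelta_ne_zero hδ (-1)) (lineDelta_mul_self hd (-1)) T hT hJ v).prod
      (C.comp ((MpPsi.toOp _).comp s))).codRestrict (MpPsi (localSchrodinger F N T v))
      (fun g => conjOp_iota_mem_localMp F E c N hcδ hδ hd T hT hJ v s hs g), fun g => rfl, fun g => rfl⟩

end ConjSection

/-! ## §3 Reading a conjugate section: `ω_{s̄} = conj ∘ ω_s ∘ conj`, smoothness -/

section Reading

variable {T}
variable (s s' : localPi E c N J v →* LocalMp F N T v) (hs' : ∀ g, MpPsi.toOp _ (s' g) = Literature.RepresentationTheory.HeisenbergGroup.conjOp (MpPsi.toOp _ (s g)))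

omit [Algebra.IsQuadraticExtension F E] in
include hs' in
/-- **`ω_{s̄}(g) f = conj (ω_s(g) (conj f))`** for a section `s̄` with conjugate operators (the hypothesis `hconj` of ★
`TwistedCoinv.nontrivial_coinv_iff_inv_of_conj`, in the form `ω_{s̄} g (Literature.RepresentationTheory.HeisenbergGroup.conjSB f) = Literature.RepresentationTheory.HeisenbergGroup.conjSB (ω_s g f)`).
[cite: MoeglinVignerasWaldspurger1987, Chap. 2 II.1 Remarque; Chap. 4 II.1] -/
theorem toRep_conjSection_conjSB (g : localPi E c N J v) (f : SchwartzBruhat (Fin N → v.adicCompletion F)) :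
    ((MpPsi.toRep (localSchrodinger F N T v)).comp s') g (Literature.RepresentationTheory.HeisenbergGroup.conjSB f) =
      Literature.RepresentationTheory.HeisenbergGroup.conjSB (((MpPsi.toRep (localSchrodinger F N T v)).comp s) g f) := by
  have h := hs' g
  simp only [MpPsi.toOp_apply] at h
  simp only [MonoidHom.coe_comp, Function.comp_apply, MpPsi.toRep_apply, h, conjOp_apply, conjSB_conjSB]

omit [Algebra.IsQuadraticExtension F E] in
include hs' in
/-- **`ω_{s̄}` is smooth when `ω_s` is**: the stabiliser of `f` under `ω_{s̄}` is the stabiliser of `conj f` under `ω_s`.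
[cite: BernsteinZelevinsky1976, §2.1] [cite: MoeglinVignerasWaldspurger1987, Chap. 2 II.1 Remarque] -/
theorem isSmooth_conjSection (hsm : Representation.IsSmooth ((MpPsi.toRep (localSchrodinger F N T v)).comp s)) :
    Representation.IsSmooth ((MpPsi.toRep (localSchrodinger F N T v)).comp s') := by
  intro f
  refine Representation.isSmoothVector_of_le _ (hsm (Literature.RepresentationTheory.HeisenbergGroup.conjSB f)) fun g hg => ?_
  rw [Representation.mem_stabilizerSubgroup] at hg ⊢
  have h := toRep_conjSection_conjSB F E c N v s s' hs' g (Literature.RepresentationTheory.HeisenbergGroup.conjSB f)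
  rw [conjSB_conjSB, hg, conjSB_conjSB] at h
  exact h

end Reading

end Literature.NumberTheory.GelbartRogawski1991.UnitaryDualPair.LocalSplitting

end
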